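import Literature.NumberTheory.Automorphic.ArchimedeanCalculusRegular
import Literature.NumberTheory.Automorphic.AutomorphicFormsStable
import HarnessLib

/-!
# The word action factors through `U(𝔤)` for a linear real group with full Lie algebra, and
Borel–Jacquet 4.3 for a general regular datum on Harish-Chandra's input alone

Topic `NumberTheory/Automorphic`; sequel of `ArchimedeanCalculusRegular` (the two calculus facts of
`ArchimedeanCalculus` for linear real groups `H` with full Lie algebra) and of
`AutomorphicFormsStable` (the reduction `automorphicForms_isStableSubmodule_of` of the named fact
`automorphicForms_isStableSubmodule 𝒟` of `AutomorphicForms`).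

* `applyFree_congr_of` — **the word action factors through `U(𝔤)` on smooth functions**
  (`applyFree_congr (ι := ι)`: `p φ = q φ` whenever `p, q ∈ ℝ⟨𝔤⟩` have the same image in `U(𝔤)`) as
  soon as Lie derivatives preserve archimedean smoothness (`isArchSmooth_lieDeriv (ι := ι)`) and
  satisfy the bracket relation `[X, Y] φ = X (Y φ) - Y (X φ)` on smooth `φ`: then
  `X ↦ (ψ ↦ X ψ)` is a Lie algebra representation on the smooth functions and `U(𝔤)` acts through
  `UniversalEnvelopingAlgebra.lift` (`envelopingAction`), computing the word action (the argument of
  `ArchimedeanEnvelopingAction.coe_envelopingAction_freeToEnveloping`, with the two inputs as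
  hypotheses instead of `𝔤 = 𝔤𝔩(N, A)`). Borel–Jacquet 1979, §1.5; Dixmier 2.1.1.
* `applyFree_congr_of_regular` — hence `applyFree_congr (ι := ι)` for every `H` with full Lie
  algebra (`isArchSmooth_lieDeriv_holds_of_regular`, `lieDeriv_bracket_of_regular`).
* For a **regular automorphy datum** `𝒟` (`AutomorphyDatum.IsRegular`, whose first field is the
  fullness of `𝔤`): `AutomorphyDatum.IsRegular.isArchSmooth_lieDeriv`,
  `AutomorphyDatum.IsRegular.applyFree_congr`, `AutomorphyDatum.IsRegular.lieDeriv_bracket`,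
  `AutomorphyDatum.IsRegular.isZFinite_lieDeriv` (Lie derivatives of smooth `Z(𝔤)`-finite functions
  are `Z(𝔤)`-finite), `IsAutomorphicForm.lieDeriv_of_hasModerateGrowth'` (`X φ` is an automorphic
  form as soon as it has moderate growth) and
  **`automorphicForms_isStableSubmodule_of_hasModerateGrowth_lieDeriv`**: the named fact
  `automorphicForms_isStableSubmodule 𝒟` (Borel–Jacquet 1979, 4.3) follows from the single analytic
  input "the Lie derivatives `X φ` of automorphic forms of a regular datum have moderate growth"
  (in print: Harish-Chandra's convolution identity `φ = φ ∗ α`, Harish-Chandra 1966, Thm. 1;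
  Borel 1997, 2.14 and 5.6), everything else being proved.

Everything here is proved; no definitions, no named facts.

## References

* A. Borel, H. Jacquet, *Automorphic forms and automorphic representations*, Proc. Sympos. Pure
  Math. 33 (Corvallis 1977), Part 1 (1979), §1.5–1.6 and 4.3 [BorelJacquetCorvallis1979].
* A. Borel, *Automorphic forms on `SL₂(ℝ)`* (1997), 2.14, 5.6 [Borel1997].
-/

noncomputable section

open scoped MatrixGroups Matrix ContDiff Topology

namespace Literature.NumberTheory.Automorphic

/-! ### The word action factors through `U(𝔤)` -/

section General

variable {A : Type*} [NormedCommRing A] [NormedAlgebra ℝ A] [NormedAlgebra ℚ A] [CompleteSpace A]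
  [StarRing A] {N : Type*} [Fintype N] [DecidableEq N] {H : RealMatrixGroup A N}
  {G : Type*} [Group G] {ι : H.carrier →* G}

/-- **The word action factors through `U(𝔤)` on smooth functions, given the two calculus inputs**:
if Lie derivatives preserve archimedean smoothness (`isArchSmooth_lieDeriv (ι := ι)`) and satisfy
`[X, Y] φ = X (Y φ) - Y (X φ)` on smooth `φ`, then `applyFree_congr (ι := ι)` holds: whenever
`p, q ∈ ℝ⟨𝔤⟩` have the same image in `U(𝔤)`, `p φ = q φ` for smooth `φ`. Indeed `X ↦ (ψ ↦ X ψ)` is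
then a real Lie algebra representation on the complex space of smooth functions, so `U(𝔤)` acts
(`envelopingAction`), and on a word `X₁ ⋯ Xₙ` this action is the iterated Lie derivative, i.e. the
word action `applyFree`. Borel–Jacquet 1979, §1.5–1.6; Dixmier, *Enveloping Algebras*, 2.1.1.
[cite: BorelJacquetCorvallis1979, §1.5] -/
theorem applyFree_congr_of (hs : isArchSmooth_lieDeriv (ι := ι))
    (hb : ∀ [FiniteDimensional ℝ A] (X Y : H.lie) {φ : G → ℂ}, IsArchSmooth ι φ →
      lieDeriv ι ⁅X, Y⁆ φ = lieDeriv ι X (lieDeriv ι Y φ) - lieDeriv ι Y (lieDeriv ι X φ)) :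
    applyFree_congr (ι := ι) := by
  intro _ p q hpq φ hφ
  -- Mathlib idiom (Mathlib/Algebra/Lie/OfAssociative.lean): the commutator Lie algebra on `End`
  letI : LieRing (Module.End ℂ (archSmooth ι)) := LieRing.ofAssociativeRing
  letI : LieAlgebra ℝ (Module.End ℂ (archSmooth ι)) := LieAlgebra.ofAssociativeAlgebra
  -- the Lie algebra representation `ρ : 𝔤 → End_ℂ (archSmooth ι)`, `X ↦ (ψ ↦ X ψ)`
  let ρ : H.lie →ₗ⁅ℝ⁆ Module.End ℂ (archSmooth ι) :=
    { toFun := fun X =>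
        { toFun := fun ψ => ⟨lieDeriv ι X ψ, (mem_archSmooth_iff ι _).2
            (hs X ((mem_archSmooth_iff ι _).1 ψ.2))⟩
          map_add' := fun ψ₁ ψ₂ => Subtype.ext (IsArchSmooth.lieDeriv_add ι X
            ((mem_archSmooth_iff ι _).1 ψ₁.2) ((mem_archSmooth_iff ι _).1 ψ₂.2))
          map_smul' := fun c ψ => Subtype.ext (lieDeriv_smul X c (ψ : G → ℂ)) }
      map_add' := fun X Y => LinearMap.ext fun ψ =>
        Subtype.ext (IsArchSmooth.lieDeriv_add_left ι ((mem_archSmooth_iff ι _).1 ψ.2) X Y)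
      map_smul' := fun a X => LinearMap.ext fun ψ => Subtype.ext (by
        change lieDeriv ι (a • X) ψ = (a : ℂ) • lieDeriv ι X ψ
        rw [IsArchSmooth.lieDeriv_smul_left ι ((mem_archSmooth_iff ι _).1 ψ.2),
          real_smul_fun_eq_coe_smul])
      map_lie' := fun {X Y} => LinearMap.ext fun ψ => Subtype.ext (by
        change lieDeriv ι ⁅X, Y⁆ ψ = lieDeriv ι X (lieDeriv ι Y ψ) - lieDeriv ι Y (lieDeriv ι X ψ)
        exact hb X Y ((mem_archSmooth_iff ι _).1 ψ.2)) }
  have hρ : ∀ (X : H.lie) (ψ : archSmooth ι), ((ρ X ψ : archSmooth ι) : G → ℂ) = lieDeriv ι X ψ :=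
    fun X ψ => rfl
  -- products of generators act by iterated Lie derivatives
  have hprod : ∀ (l : List H.lie) (ψ : archSmooth ι),
      (((l.map ρ).prod ψ : archSmooth ι) : G → ℂ) = iterLieDeriv ι l ψ := by
    intro l
    induction l with
    | nil => intro ψ; simp
    | cons X l ih =>
      intro ψ
      rw [List.map_cons, List.prod_cons, Module.End.mul_apply, hρ, ih, iterLieDeriv_cons]
  -- the composite `ℝ⟨𝔤⟩ → U(𝔤) → End`, evaluated at a smooth `ψ`, computes the word action
  have hfree : ∀ (r : FreeAlgebra ℝ H.lie) (ψ : archSmooth ι),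
      ((envelopingAction ρ (freeToEnveloping H r) ψ : archSmooth ι) : G → ℂ) = applyFree ι r ψ := by
    intro r ψ
    set Aρ : FreeAlgebra ℝ H.lie →ₐ[ℝ] Module.End ℂ (archSmooth ι) :=
      (envelopingAction ρ).comp (freeToEnveloping H) with hAρ
    let R : FreeAlgebra ℝ H.lie →ₗ[ℝ] (G → ℂ) :=
      { toFun := fun r' => ((Aρ r' ψ : archSmooth ι) : G → ℂ)
        map_add' := fun r₁ r₂ => by rw [map_add, LinearMap.add_apply, Submodule.coe_add]
        map_smul' := fun a r' => by
          rw [map_smul, LinearMap.smul_apply, RingHom.id_apply, real_smul_fun_eq_coe_smul]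
          rfl }
    let L : FreeAlgebra ℝ H.lie →ₗ[ℝ] (G → ℂ) :=
      { toFun := fun r' => applyFree ι r' ψ
        map_add' := fun r₁ r₂ => applyFree_add ι r₁ r₂ _
        map_smul' := fun c r' => by
          rw [applyFree_smul_left, RingHom.id_apply, real_smul_fun_eq_coe_smul] }
    suffices hRL : R = L from LinearMap.congr_fun hRL r
    refine (FreeAlgebra.basisFreeMonoid ℝ H.lie).ext fun w => ?_
    change ((Aρ (FreeAlgebra.basisFreeMonoid ℝ H.lie w) ψ : archSmooth ι) : G → ℂ) =
      applyFree ι (FreeAlgebra.basisFreeMonoid ℝ H.lie w) ψ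
    rw [applyFree_basisFreeMonoid, basisFreeMonoid_eq_lift, ← FreeMonoid.ofList_toList w,
      FreeMonoid.lift_apply, FreeMonoid.toList_ofList, hAρ, map_list_prod, List.map_map]
    have hcomp : ((envelopingAction ρ).comp (freeToEnveloping H) : _ → _) ∘ FreeAlgebra.ι ℝ =
        (ρ : H.lie → Module.End ℂ (archSmooth ι)) := by
      funext X
      change envelopingAction ρ (freeToEnveloping H (FreeAlgebra.ι ℝ X)) = _
      rw [freeToEnveloping_ι, envelopingAction_ι]
    rw [hcomp]
    exact hprod _ ψ
  rw [← hfree p ⟨φ, hφ⟩, ← hfree q ⟨φ, hφ⟩, hpq]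

/-- **`applyFree_congr` for linear real groups with full Lie algebra** (discharge of the named fact
of `ArchimedeanCalculus` for such `H`): if every `X` with `exp (tX) ∈ H` for all `t` lies in `𝔤`,
then on smooth functions the word action of `ℝ⟨𝔤⟩` factors through `U(𝔤)`
(`applyFree_congr_of` with `isArchSmooth_lieDeriv_holds_of_regular` and
`lieDeriv_bracket_of_regular`). Borel–Jacquet 1979, §1.5; Dixmier 2.1.1.
[cite: BorelJacquetCorvallis1979, §1.5] -/
theorem applyFree_congr_of_regular
    (hreg : ∀ X : Matrix N N A, (∀ t : ℝ, expGL (t • X) ∈ H.carrier) → X ∈ H.lie) :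
    applyFree_congr (ι := ι) :=
  applyFree_congr_of (isArchSmooth_lieDeriv_holds_of_regular ι hreg)
    fun X Y _ hφ => lieDeriv_bracket_of_regular ι hreg X Y hφ

end General

/-! ### Regular automorphy data -/

section Datum

variable {K : Type} [Field K] [NumberField K]
  {A : Type*} [NormedCommRing A] [NormedAlgebra ℝ A] [NormedAlgebra ℚ A] [CompleteSpace A]
  [StarRing A] {N : Type*} [Fintype N] [DecidableEq N]
  {𝒢 : AdelicGroupData K} {𝒟 : AutomorphyDatum 𝒢 A N}

/-- **Lie derivatives of archimedean-smooth functions are archimedean-smooth, for a regular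
datum**: the named fact `isArchSmooth_lieDeriv` of `ArchimedeanCalculus` holds for the archimedean
inclusion `𝒟.ofArch : G_∞ → G(𝔸_K)` of a regular automorphy datum (`𝔤` is the full Lie algebra of
`G_∞`, `IsRegular.mem_lie_of_expGL_mem`; `isArchSmooth_lieDeriv_holds_of_regular`).
Borel–Jacquet 1979, §1.5 and §4.1. [cite: BorelJacquetCorvallis1979, §1.5] -/
theorem AutomorphyDatum.IsRegular.isArchSmooth_lieDeriv (h𝒟 : 𝒟.IsRegular) :
    isArchSmooth_lieDeriv (ι := 𝒟.ofArch) :=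
  isArchSmooth_lieDeriv_holds_of_regular 𝒟.ofArch h𝒟.mem_lie_of_expGL_mem

/-- **The bracket relation for a regular datum**: `[X, Y] φ = X (Y φ) - Y (X φ)` for `φ` smooth in
the archimedean variable and `X, Y ∈ 𝔤` (`lieDeriv_bracket_of_regular`).
Borel–Jacquet 1979, §1.5 and §4.1. [cite: BorelJacquetCorvallis1979, §1.5] -/
theorem AutomorphyDatum.IsRegular.lieDeriv_bracket [FiniteDimensional ℝ A] (h𝒟 : 𝒟.IsRegular)
    (X Y : 𝒟.arch.lie) {φ : 𝒢.Adelic → ℂ} (hφ : IsArchSmooth 𝒟.ofArch φ) :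
    lieDeriv 𝒟.ofArch ⁅X, Y⁆ φ =
      lieDeriv 𝒟.ofArch X (lieDeriv 𝒟.ofArch Y φ) - lieDeriv 𝒟.ofArch Y (lieDeriv 𝒟.ofArch X φ) :=
  lieDeriv_bracket_of_regular 𝒟.ofArch h𝒟.mem_lie_of_expGL_mem X Y hφ

/-- **The word action factors through `U(𝔤)` for a regular datum**: the named fact
`applyFree_congr` of `ArchimedeanCalculus` holds for `𝒟.ofArch` (`applyFree_congr_of_regular`).
Borel–Jacquet 1979, §1.5 and §4.1. [cite: BorelJacquetCorvallis1979, §1.5] -/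
theorem AutomorphyDatum.IsRegular.applyFree_congr (h𝒟 : 𝒟.IsRegular) :
    applyFree_congr (ι := 𝒟.ofArch) :=
  applyFree_congr_of_regular h𝒟.mem_lie_of_expGL_mem

/-- **Lie derivatives of smooth `Z(𝔤)`-finite functions are `Z(𝔤)`-finite, for a regular datum**
(`isZFinite_lieDeriv_of` with the two calculus facts now proved). Borel–Jacquet 1979, 4.3
(`Z(𝔤)`-finiteness of `X φ`, `Z(𝔤)` being central). [cite: BorelJacquetCorvallis1979, 4.3] -/
theorem AutomorphyDatum.IsRegular.isZFinite_lieDeriv [FiniteDimensional ℝ A] (h𝒟 : 𝒟.IsRegular)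
    {φ : 𝒢.Adelic → ℂ} (hφ : IsArchSmooth 𝒟.ofArch φ) (hZ : IsZFinite 𝒟.ofArch φ)
    (X : 𝒟.arch.lie) : IsZFinite 𝒟.ofArch (lieDeriv 𝒟.ofArch X φ) :=
  isZFinite_lieDeriv_of h𝒟.isArchSmooth_lieDeriv h𝒟.applyFree_congr hφ hZ X

/-- **`X φ` is an automorphic form as soon as it has moderate growth, for a regular datum**
(Borel–Jacquet 1979, 4.3 with its one deep input displayed): if `φ` is an automorphic form of a
regular datum over a finite-dimensional coefficient algebra and `X φ` has moderate growth, then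
`X φ` is an automorphic form (`IsAutomorphicForm.lieDeriv_of_hasModerateGrowth` with the calculus
facts proved: smoothness, `K_∞`-finiteness and `Z(𝔤)`-finiteness of `X φ` are theorems).
[cite: BorelJacquetCorvallis1979, 4.3] -/
theorem IsAutomorphicForm.lieDeriv_of_hasModerateGrowth' [FiniteDimensional ℝ A]
    (h𝒟 : 𝒟.IsRegular) {φ : 𝒢.Adelic → ℂ} (hφ : IsAutomorphicForm 𝒟 φ) (X : 𝒟.arch.lie)
    (hX : HasModerateGrowth 𝒟 (lieDeriv 𝒟.ofArch X φ)) :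
    IsAutomorphicForm 𝒟 (lieDeriv 𝒟.ofArch X φ) :=
  hφ.lieDeriv_of_hasModerateGrowth h𝒟.isArchSmooth_lieDeriv h𝒟.applyFree_congr X hX

/-- **Borel–Jacquet 4.3 for a general regular datum on Harish-Chandra's input alone**: the named
fact `automorphicForms_isStableSubmodule 𝒟` of `AutomorphicForms` — the space of automorphic forms of
a regular automorphy datum over a finite-dimensional coefficient algebra is a
`(𝔤, K_∞) × G(𝔸_f)`-stable subspace — follows from the moderate growth of the Lie derivatives
`X φ` of automorphic forms (in print `X φ = φ ∗ α'` by Harish-Chandra's convolution identity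
`φ = φ ∗ α`; Harish-Chandra 1966, Thm. 1; Borel 1997, 2.14 and 5.6 (c)); the group part, the
`𝔨`-part, the calculus of `§1.5` (von Neumann–Cartan) and the assembly are theorems
(`automorphicForms_isStableSubmodule_of`, `AutomorphicFormsStable`; `ArchimedeanCalculusRegular`).
[cite: BorelJacquetCorvallis1979, 4.3] -/
theorem automorphicForms_isStableSubmodule_of_hasModerateGrowth_lieDeriv
    (hg : ∀ [FiniteDimensional ℝ A], 𝒟.IsRegular → ∀ φ : 𝒢.Adelic → ℂ, IsAutomorphicForm 𝒟 φ →
      ∀ X : 𝒟.arch.lie, HasModerateGrowth 𝒟 (lieDeriv 𝒟.ofArch X φ)) :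
    automorphicForms_isStableSubmodule 𝒟 := by
  intro _ h𝒟
  exact automorphicForms_isStableSubmodule_of h𝒟.isArchSmooth_lieDeriv h𝒟.applyFree_congr hg h𝒟

end Datum

end Literature.NumberTheory.Automorphic
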